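import Literature.Geometry.Manifold.CircleSubmersionConnectedFibres
import Literature.AlgebraicTopology.Homotopy.SerreFibrationPreimages
import Literature.AlgebraicTopology.Homotopy.SerreFibrationCube
import HarnessLib

/-!
# Locally trivial fibrations are Serre fibrations

Topic `Literature/AlgebraicTopology/Homotopy`. A locally trivial fibration `p : E → B` in the sense
of Bröcker–Jänich (8.12) (`IsLocallyTrivialFibration`: every point of the base has a neighbourhood
`U` with `U × p⁻¹(b) ≃ p⁻¹U` over `U`; the fibres may vary from one path component of `B` to the
next) is a Serre fibration (`IsLocallyTrivialFibration.isSerreFibration`): a relative cube lifting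
problem lives over the path component `C` of the base point, over which `p` is a fibre bundle with
a fixed fibre (`Literature.Geometry.Manifold.isFibreBundleWith_of_isLocallyTrivialFibration`), and
fibre bundles are Serre fibrations (Hatcher, Prop. 4.48; the tree's
`IsFibreBundleWith.isSerreFibration`). Also: the restriction of a locally trivial fibration over a
subset of the base is locally trivial (`IsLocallyTrivialFibration.restrictPreimage`).

Everything is proved; no named fact.

## References

* A. Hatcher, *Algebraic Topology*, CUP (2002), §4.2 Prop. 4.48 (p. 379), p. 376. [HatcherAT2002]
* T. Bröcker, K. Jänich, *Introduction to Differential Topology*, CUP (1982), (8.12).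
  [BrockerJanichIDT1982]
-/

noncomputable section

open Set Function
open scoped Topology unitInterval

namespace Literature.AlgebraicTopology.Homotopy

universe u v

variable {E : Type u} {B : Type v} [TopologicalSpace E] [TopologicalSpace B] {p : E → B}

namespace IsLocallyTrivialFibration

/-- **The restriction of a locally trivial fibration over a subset of the base is locally
trivial** (restrict the trivialisations). [cite: BrockerJanichIDT1982, (8.12)] -/
theorem restrictPreimage (h : IsLocallyTrivialFibration p) (C : Set B) :
    IsLocallyTrivialFibration (C.restrictPreimage p) := by
  intro c
  obtain ⟨U, hUo, hcU, φ, hφ⟩ := h c.1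
  -- membership bookkeeping
  have hpφ : ∀ x, p (φ x : E) = x.1 := hφ
  have hfib : ∀ e : ↥((C.restrictPreimage p) ⁻¹' {c}), (e.1 : E) ∈ p ⁻¹' {(c : B)} := fun e =>
    congrArg Subtype.val e.2
  let eF : ↥((C.restrictPreimage p) ⁻¹' {c}) → ↥(p ⁻¹' {(c : B)}) := fun e => ⟨e.1.1, hfib e⟩
  have heF : Continuous eF := (continuous_subtype_val.comp continuous_subtype_val).subtype_mk _
  -- forward map
  have hmemC : ∀ x : ↥(Subtype.val ⁻¹' U : Set ↥C) × ↥((C.restrictPreimage p) ⁻¹' {c}),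
      (φ (⟨x.1.1.1, x.1.2⟩, eF x.2) : E) ∈ p ⁻¹' C := fun x => by
    show p _ ∈ C
    rw [hpφ]; exact x.1.1.2
  have hmemU : ∀ x : ↥(Subtype.val ⁻¹' U : Set ↥C) × ↥((C.restrictPreimage p) ⁻¹' {c}),
      (⟨_, hmemC x⟩ : ↥(p ⁻¹' C)) ∈ (C.restrictPreimage p) ⁻¹' (Subtype.val ⁻¹' U) := fun x => by
    show p _ ∈ U
    rw [hpφ]; exact x.1.2
  -- backward map
  have hzU : ∀ z : ↥((C.restrictPreimage p) ⁻¹' (Subtype.val ⁻¹' U : Set ↥C)), (z.1.1 : E) ∈ p ⁻¹' U :=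
    fun z => z.2
  have hwC : ∀ z : ↥((C.restrictPreimage p) ⁻¹' (Subtype.val ⁻¹' U : Set ↥C)),
      ((φ.symm ⟨z.1.1, hzU z⟩).1 : B) ∈ C := fun z => by
    have h1 : ((φ.symm ⟨z.1.1, hzU z⟩).1 : B) = p z.1.1 := by
      rw [← hpφ (φ.symm ⟨z.1.1, hzU z⟩), Homeomorph.apply_symm_apply]
    rw [h1]; exact z.1.2
  have hwF : ∀ z : ↥((C.restrictPreimage p) ⁻¹' (Subtype.val ⁻¹' U : Set ↥C)),
      (⟨((φ.symm ⟨z.1.1, hzU z⟩).2 : E), by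
        have h2 : p ((φ.symm ⟨z.1.1, hzU z⟩).2 : E) = c := (φ.symm ⟨z.1.1, hzU z⟩).2.2
        show p _ ∈ C
        rw [h2]; exact c.2⟩ : ↥(p ⁻¹' C)) ∈ (C.restrictPreimage p) ⁻¹' {c} := fun z => by
    apply Subtype.ext
    exact (φ.symm ⟨z.1.1, hzU z⟩).2.2
  refine ⟨Subtype.val ⁻¹' U, hUo.preimage continuous_subtype_val, hcU,
    { toFun := fun x => ⟨⟨_, hmemC x⟩, hmemU x⟩
      invFun := fun z => (⟨⟨(φ.symm ⟨z.1.1, hzU z⟩).1, hwC z⟩, (φ.symm ⟨z.1.1, hzU z⟩).1.2⟩, ⟨_, hwF z⟩)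
      left_inv := fun x => ?_
      right_inv := fun z => ?_
      continuous_toFun := ?_
      continuous_invFun := ?_ }, fun x => Subtype.ext (hpφ _)⟩
  · -- left inverse
    have hx : φ.symm ⟨(φ (⟨x.1.1.1, x.1.2⟩, eF x.2) : E), by
        show p _ ∈ U; rw [hpφ]; exact x.1.2⟩ = (⟨x.1.1.1, x.1.2⟩, eF x.2) := by
      have h1 : (⟨(φ (⟨x.1.1.1, x.1.2⟩, eF x.2) : E), by show p _ ∈ U; rw [hpφ]; exact x.1.2⟩ : ↥(p ⁻¹' U)) =
          φ (⟨x.1.1.1, x.1.2⟩, eF x.2) := Subtype.ext rfl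
      rw [h1, Homeomorph.symm_apply_apply]
    obtain ⟨⟨⟨b, hbC⟩, hbU⟩, e⟩ := x
    apply Prod.ext
    · apply Subtype.ext; apply Subtype.ext
      show ((φ.symm _).1 : B) = b
      rw [hx]
    · apply Subtype.ext; apply Subtype.ext
      show ((φ.symm _).2 : E) = e.1.1
      rw [hx]
  · -- right inverse
    apply Subtype.ext; apply Subtype.ext
    show (φ (⟨(φ.symm ⟨z.1.1, hzU z⟩).1.1, _⟩, ⟨((φ.symm ⟨z.1.1, hzU z⟩).2 : E), _⟩) : E) = z.1.1
    have : ((⟨(φ.symm ⟨z.1.1, hzU z⟩).1.1, (φ.symm ⟨z.1.1, hzU z⟩).1.2⟩ : ↥U),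
        (⟨((φ.symm ⟨z.1.1, hzU z⟩).2 : E), (φ.symm ⟨z.1.1, hzU z⟩).2.2⟩ : ↥(p ⁻¹' {(c : B)}))) =
        φ.symm ⟨z.1.1, hzU z⟩ := rfl
    rw [this, Homeomorph.apply_symm_apply]
  · -- continuity of the forward map
    refine Continuous.subtype_mk (Continuous.subtype_mk ?_ _) _
    refine continuous_subtype_val.comp (φ.continuous.comp (Continuous.prodMk ?_ (heF.comp continuous_snd)))
    exact ((continuous_subtype_val.comp continuous_subtype_val).comp continuous_fst).subtype_mk _
  · -- continuity of the backward map
    have hψ : Continuous fun z : ↥((C.restrictPreimage p) ⁻¹' (Subtype.val ⁻¹' U : Set ↥C)) =>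
        φ.symm ⟨z.1.1, hzU z⟩ :=
      φ.symm.continuous.comp ((continuous_subtype_val.comp continuous_subtype_val).subtype_mk _)
    refine Continuous.prodMk ?_ ?_
    · exact (((continuous_subtype_val.comp (continuous_fst.comp hψ)).subtype_mk _).subtype_mk _)
    · exact (((continuous_subtype_val.comp (continuous_snd.comp hψ)).subtype_mk _).subtype_mk _)

/-- **A locally trivial fibration is a Serre fibration** (fibres may vary between path components
of the base): a relative cube lifting problem lives over the path component `C` of its base point,
over which `p` is a fibre bundle with fixed fibre (`isFibreBundleWith_of_isLocallyTrivialFibration`),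
hence a Serre fibration (Hatcher, Prop. 4.48). [cite: HatcherAT2002, §4.2 Prop. 4.48 (p. 379)]
[cite: BrockerJanichIDT1982, (8.12)] -/
theorem isSerreFibration (h : IsLocallyTrivialFibration p) (hp : Continuous p) : IsSerreFibration p := by
  refine ⟨hp, fun m K g hg hgK => ?_⟩
  -- the path component of the base point `K(0, 0)`
  let z₀ : I × (Fin m → I) := (0, fun _ => 0)
  have hz₀ : z₀ ∈ relLiftSource (Fin m) := mem_relLiftSource.2 (Or.inl rfl)
  let C : Set B := pathComponent (K z₀)
  haveI : ContractibleSpace I := (convex_Icc (0 : ℝ) 1).contractibleSpace ⟨0, left_mem_Icc.2 zero_le_one⟩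
  haveI := SerreCube.contractibleSpace_cube m
  have hKC : ∀ z, K z ∈ C := fun z =>
    ⟨(PathConnectedSpace.somePath z₀ z).map K.continuous⟩
  haveI : PathConnectedSpace ↥C := isPathConnected_iff_pathConnectedSpace.1 isPathConnected_pathComponent
  have hFB := Literature.Geometry.Manifold.isFibreBundleWith_of_isLocallyTrivialFibration
    (hp.restrictPreimage (s := C)) (h.restrictPreimage C) ⟨K z₀, mem_pathComponent_self _⟩
  have hS : IsSerreFibration (C.restrictPreimage p) := hFB.isSerreFibration
  -- corestrict the data
  let K' : C(I × (Fin m → I), ↥C) := ⟨fun z => ⟨K z, hKC z⟩, K.continuous.subtype_mk _⟩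
  have hg₀ : p (g z₀) ∈ C := by rw [hgK z₀ hz₀]; exact hKC z₀
  classical
  let g' : I × (Fin m → I) → ↥(p ⁻¹' C) := fun z =>
    if hz : z ∈ relLiftSource (Fin m) then ⟨g z, by show p (g z) ∈ C; rw [hgK z hz]; exact hKC z⟩
    else ⟨g z₀, hg₀⟩
  have hg'eq : ∀ z ∈ relLiftSource (Fin m), (g' z : E) = g z := fun z hz => by
    simp only [g', dif_pos hz]
  have hg' : ContinuousOn g' (relLiftSource (Fin m)) := by
    rw [continuousOn_iff_continuous_restrict]
    have hr : Continuous ((relLiftSource (Fin m)).restrict g) :=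
      continuousOn_iff_continuous_restrict.1 hg
    have heq : (relLiftSource (Fin m)).restrict g' =
        fun z => (⟨g z.1, by show p (g z.1) ∈ C; rw [hgK z.1 z.2]; exact hKC z.1⟩ : ↥(p ⁻¹' C)) := by
      funext z
      apply Subtype.ext
      exact hg'eq z.1 z.2
    rw [heq]
    exact hr.subtype_mk _
  have hg'K : ∀ z ∈ relLiftSource (Fin m), C.restrictPreimage p (g' z) = K' z := fun z hz => by
    apply Subtype.ext
    show p (g' z : E) = K z
    rw [hg'eq z hz, hgK z hz]
  obtain ⟨G, hGK, hGg⟩ := hS.2 m K' g' hg' hg'K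
  refine ⟨⟨fun z => (G z : E), continuous_subtype_val.comp G.continuous⟩, fun z => ?_, fun z hz => ?_⟩
  · exact congrArg Subtype.val (hGK z)
  · show (G z : E) = g z
    rw [hGg z hz, hg'eq z hz]

end IsLocallyTrivialFibration

end Literature.AlgebraicTopology.Homotopy
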